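import Summits.BirchSwinnertonDyer.Rank1Residual.X10.CMPartnerTransport
import Literature.NumberTheory.EllipticCurves.RationalIsogenyFrobeniusCertificates11
import HarnessLib

/-!
# Class X10b (N2), the K-CM road at `p = 3`: kernel data of the CM PARTNER curves, part A
# (121b1, 256a1, 256d1, 1936f1, 3025a1, 5929a1, 7744a1, 7744s1, 20449a1) — `Δ ≠ 0`, global minimality, `j ∈ maximalCMJInvariants`, `#Ã(𝔽₃)` (cell `b2b-bsdres`,
# unit `b2b-bsdres-x10` = N2 class lead, gen 19)

HONEST FRAMING (run/shared/lean/b2b/bsd-rank1-residual/, verbatim in every file): the goal of the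
cell is to DELETE the COMBINATION-SHAPED residual classes of the Birch–Swinnerton-Dyer formula for
ALL analytic-rank `≤ 1` elliptic curves over `ℚ` — "full BSD formula for every rank `≤ 1` curve in
class `C`" assembled STRICTLY from published theorems — so that the rank-`≤ 1` remainder becomes
exactly the CONSTRUCTION-SHAPED classes, which are TYPED (missing-input `Prop`s), NOT attempted.
This is not "finishing BSD". Theorems only; NO named fact is introduced; class X10b keeps its label
CONSTRUCTION-SHAPED (NEEDS X_A3); nothing is booked by this file (the lane books, the referee rules);
everything is PER PAIR / per curve.

The 17 CM curves serving the 94 open K-CM cells of N2 (`HOME/b2b-bsdres-x10/g19/N2-CLOSURE-MAP-g19.md`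
§2; cc-typer-1 `class-closure/typer-1/x3e/N2-CM-partners-typer1.tsv`) are quadratic twists of `121b1`
(`j = -32768 = -2¹⁵`, CM by `ℤ[(1+√-11)/2]`) or of `256a1` (`j = 8000 = 2⁶·5³`, CM by `ℤ[√-2]`), all GOOD
at `3` (`3` splits in both fields, so good ⟹ ordinary). For each Cremona model (curve #1 of its class, the
maximal-order member) this file records, decided in the kernel: `Δ ≠ 0` (`isElliptic_cm…`), global
minimality by Kraus' bounded criterion (`isGloballyMinimal_cm…`), `j ∈ maximalCMJInvariants`
(`j_mem_cm…`: `j = c₄³/Δ` evaluated by `norm_num`) and `#Ã(𝔽₃)` by Euler's criterion (`card_cm…_3`).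
These discharge the partner-side hypotheses `hjA`, `h3ΔA`, `hcard3A`, `hord3A` and the instance binders
of `X10/CMPartnerTransport.lean` in the per-pair records `X10/CMPartnerRecords*.lean`. Data only;
nothing about a class; nothing booked.

References: J. E. Cremona, *Algorithms for Modular Elliptic Curves*, tables [Cremona2006]; J. H. Silverman,
*AEC* (2009) VII.1 Rem. 1.1, App. C §11 [SilvermanAEC2009]; A. Kraus, Manuscripta Math. 65 (1989) [Kraus1989].
-/

set_option autoImplicit false
set_option maxRecDepth 4096

noncomputable section

open scoped Classical MatrixGroups ModularForm

open CongruenceSubgroup WeierstrassCurve Literature.NumberTheory.EllipticCurves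
  Literature.NumberTheory.EllipticCurves.ModularForms Literature.NumberTheory.EllipticCurves.Rank1Residual
  Literature.NumberTheory.EllipticCurves.Rank1Residual.Typed
  Literature.NumberTheory.EllipticCurves.Rank1Residual.X11RankOneCertificates
  Literature.NumberTheory.EllipticCurves.Wuthrich2014
  Summit.BirchSwinnertonDyer.BirchSwinnertonDyer.Rank1Residual.IntModel
  Summit.BirchSwinnertonDyer.BirchSwinnertonDyer.Rank1Residual.X11RankOne
  Summit.BirchSwinnertonDyer.BirchSwinnertonDyer.Theorems.Rank1ResidualX1Defs
  Summit.BirchSwinnertonDyer.Rank1Residual.X11b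

namespace Summit.BirchSwinnertonDyer.Rank1Residual.X10.CMPartnerCurves

/-- `121b1`'s Cremona model is an elliptic curve (`Δ ≠ 0`, kernel). [cite: Cremona2006, Table 1 (Cremona label 121b1)] -/
theorem isElliptic_cm121b1 : (⟨0, -1, 1, -7, 10⟩ : WeierstrassCurve ℚ).IsElliptic :=
  isElliptic_of_discOf_ne_zero 0 (-1) 1 (-7) 10 (by decide +kernel)

/-- `121b1`'s Cremona model is globally minimal (Kraus' bounded criterion, kernel). [cite: SilvermanAEC2009, VII.1 Remark 1.1] -/
theorem isGloballyMinimal_cm121b1 : (⟨0, -1, 1, -7, 10⟩ : WeierstrassCurve ℚ).IsGloballyMinimal :=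
  isGloballyMinimal_of_krausCriterion_bounded₂ 0 (-1) 1 (-7) 10 (by decide +kernel) (by decide +kernel)
    (by decide +kernel)

/-- `j(121b1) = -32768 ∈ maximalCMJInvariants` (CM by the MAXIMAL order of `ℚ(√-11)`; kernel arithmetic on the literal model).
[cite: SilvermanAEC2009, App. C §11.3.1] [cite: Cremona2006, Table 1 (Cremona label 121b1)] -/
theorem j_mem_cm121b1 :
    (haveI := isElliptic_cm121b1; (⟨0, -1, 1, -7, 10⟩ : WeierstrassCurve ℚ).j) ∈ maximalCMJInvariants := by
  haveI := isElliptic_cm121b1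
  have hj : (⟨0, -1, 1, -7, 10⟩ : WeierstrassCurve ℚ).j = -32768 := by
    rw [j, Units.inv_mul_eq_iff_eq_mul, coe_Δ']
    norm_num [WeierstrassCurve.c₄, WeierstrassCurve.Δ, WeierstrassCurve.b₂, WeierstrassCurve.b₄,
      WeierstrassCurve.b₆, WeierstrassCurve.b₈]
  rw [hj]
  simp [maximalCMJInvariants]

/- `#Ã(𝔽₃) = 5` (`a₃ = -1`) for `121b1` is ALREADY in the tree as
`Literature.NumberTheory.EllipticCurves.KenkuLevelsCert.card_E11_jm32768_3`
(`RationalIsogenyFrobeniusCertificates11.lean`); the records reuse it (dedup). -/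

/-- `256a1`'s Cremona model is an elliptic curve (`Δ ≠ 0`, kernel). [cite: Cremona2006, Table 1 (Cremona label 256a1)] -/
theorem isElliptic_cm256a1 : (⟨0, 1, 0, -3, 1⟩ : WeierstrassCurve ℚ).IsElliptic :=
  isElliptic_of_discOf_ne_zero 0 1 0 (-3) 1 (by decide +kernel)

/-- `256a1`'s Cremona model is globally minimal (Kraus' bounded criterion, kernel). [cite: SilvermanAEC2009, VII.1 Remark 1.1] -/
theorem isGloballyMinimal_cm256a1 : (⟨0, 1, 0, -3, 1⟩ : WeierstrassCurve ℚ).IsGloballyMinimal :=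
  isGloballyMinimal_of_krausCriterion_bounded₂ 0 1 0 (-3) 1 (by decide +kernel) (by decide +kernel)
    (by decide +kernel)

/-- `j(256a1) = 8000 ∈ maximalCMJInvariants` (CM by the MAXIMAL order of `ℚ(√-2)`; kernel arithmetic on the literal model).
[cite: SilvermanAEC2009, App. C §11.3.1] [cite: Cremona2006, Table 1 (Cremona label 256a1)] -/
theorem j_mem_cm256a1 :
    (haveI := isElliptic_cm256a1; (⟨0, 1, 0, -3, 1⟩ : WeierstrassCurve ℚ).j) ∈ maximalCMJInvariants := by
  haveI := isElliptic_cm256a1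
  have hj : (⟨0, 1, 0, -3, 1⟩ : WeierstrassCurve ℚ).j = 8000 := by
    rw [j, Units.inv_mul_eq_iff_eq_mul, coe_Δ']
    norm_num [WeierstrassCurve.c₄, WeierstrassCurve.Δ, WeierstrassCurve.b₂, WeierstrassCurve.b₄,
      WeierstrassCurve.b₆, WeierstrassCurve.b₈]
  rw [hj]
  simp [maximalCMJInvariants]

/-- `#Ã(𝔽₃) = 6` (`a₃ = -2`: GOOD ORDINARY at `3`) for the CM partner `256a1` (kernel count). [folklore] -/
theorem card_cm256a1_3 :
    Nat.card (((⟨0, 1, 0, -3, 1⟩ : WeierstrassCurve ℤ).map (Int.castRingHom (ZMod 3))).toAffine.Point) = 6 := by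
  rw [@WeierstrassCurve.natCard_point_eq_one_add_card (ZMod 3) (@ZMod.instField 3 ⟨by norm_num⟩) _ _ _
    (by decide +kernel), @card_sol_eq_sum_euler (ZMod 3) (@ZMod.instField 3 ⟨by norm_num⟩) _ _
    (by rw [ZMod.ringChar_zmod_n]; decide), ZMod.card]
  decide +kernel
/-- `256d1`'s Cremona model is an elliptic curve (`Δ ≠ 0`, kernel). [cite: Cremona2006, Table 1 (Cremona label 256d1)] -/
theorem isElliptic_cm256d1 : (⟨0, -1, 0, -3, -1⟩ : WeierstrassCurve ℚ).IsElliptic :=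
  isElliptic_of_discOf_ne_zero 0 (-1) 0 (-3) (-1) (by decide +kernel)

/-- `256d1`'s Cremona model is globally minimal (Kraus' bounded criterion, kernel). [cite: SilvermanAEC2009, VII.1 Remark 1.1] -/
theorem isGloballyMinimal_cm256d1 : (⟨0, -1, 0, -3, -1⟩ : WeierstrassCurve ℚ).IsGloballyMinimal :=
  isGloballyMinimal_of_krausCriterion_bounded₂ 0 (-1) 0 (-3) (-1) (by decide +kernel) (by decide +kernel)
    (by decide +kernel)

/-- `j(256d1) = 8000 ∈ maximalCMJInvariants` (CM by the MAXIMAL order of `ℚ(√-2)`; kernel arithmetic on the literal model).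
[cite: SilvermanAEC2009, App. C §11.3.1] [cite: Cremona2006, Table 1 (Cremona label 256d1)] -/
theorem j_mem_cm256d1 :
    (haveI := isElliptic_cm256d1; (⟨0, -1, 0, -3, -1⟩ : WeierstrassCurve ℚ).j) ∈ maximalCMJInvariants := by
  haveI := isElliptic_cm256d1
  have hj : (⟨0, -1, 0, -3, -1⟩ : WeierstrassCurve ℚ).j = 8000 := by
    rw [j, Units.inv_mul_eq_iff_eq_mul, coe_Δ']
    norm_num [WeierstrassCurve.c₄, WeierstrassCurve.Δ, WeierstrassCurve.b₂, WeierstrassCurve.b₄,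
      WeierstrassCurve.b₆, WeierstrassCurve.b₈]
  rw [hj]
  simp [maximalCMJInvariants]

/-- `#Ã(𝔽₃) = 2` (`a₃ = 2`: GOOD ORDINARY at `3`) for the CM partner `256d1` (kernel count). [folklore] -/
theorem card_cm256d1_3 :
    Nat.card (((⟨0, -1, 0, -3, -1⟩ : WeierstrassCurve ℤ).map (Int.castRingHom (ZMod 3))).toAffine.Point) = 2 := by
  rw [@WeierstrassCurve.natCard_point_eq_one_add_card (ZMod 3) (@ZMod.instField 3 ⟨by norm_num⟩) _ _ _
    (by decide +kernel), @card_sol_eq_sum_euler (ZMod 3) (@ZMod.instField 3 ⟨by norm_num⟩) _ _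
    (by rw [ZMod.ringChar_zmod_n]; decide), ZMod.card]
  decide +kernel
/-- `1936f1`'s Cremona model is an elliptic curve (`Δ ≠ 0`, kernel). [cite: Cremona2006, Table 1 (Cremona label 1936f1)] -/
theorem isElliptic_cm1936f1 : (⟨0, 1, 0, -117, -541⟩ : WeierstrassCurve ℚ).IsElliptic :=
  isElliptic_of_discOf_ne_zero 0 1 0 (-117) (-541) (by decide +kernel)

/-- `1936f1`'s Cremona model is globally minimal (Kraus' bounded criterion, kernel). [cite: SilvermanAEC2009, VII.1 Remark 1.1] -/
theorem isGloballyMinimal_cm1936f1 : (⟨0, 1, 0, -117, -541⟩ : WeierstrassCurve ℚ).IsGloballyMinimal :=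
  isGloballyMinimal_of_krausCriterion_bounded 0 1 0 (-117) (-541) (by decide +kernel) (by decide +kernel)
    (by decide +kernel)

/-- `j(1936f1) = -32768 ∈ maximalCMJInvariants` (CM by the MAXIMAL order of `ℚ(√-11)`; kernel arithmetic on the literal model).
[cite: SilvermanAEC2009, App. C §11.3.1] [cite: Cremona2006, Table 1 (Cremona label 1936f1)] -/
theorem j_mem_cm1936f1 :
    (haveI := isElliptic_cm1936f1; (⟨0, 1, 0, -117, -541⟩ : WeierstrassCurve ℚ).j) ∈ maximalCMJInvariants := by
  haveI := isElliptic_cm1936f1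
  have hj : (⟨0, 1, 0, -117, -541⟩ : WeierstrassCurve ℚ).j = -32768 := by
    rw [j, Units.inv_mul_eq_iff_eq_mul, coe_Δ']
    norm_num [WeierstrassCurve.c₄, WeierstrassCurve.Δ, WeierstrassCurve.b₂, WeierstrassCurve.b₄,
      WeierstrassCurve.b₆, WeierstrassCurve.b₈]
  rw [hj]
  simp [maximalCMJInvariants]

/-- `#Ã(𝔽₃) = 3` (`a₃ = 1`: GOOD ORDINARY at `3`) for the CM partner `1936f1` (kernel count). [folklore] -/
theorem card_cm1936f1_3 :
    Nat.card (((⟨0, 1, 0, -117, -541⟩ : WeierstrassCurve ℤ).map (Int.castRingHom (ZMod 3))).toAffine.Point) = 3 := by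
  rw [@WeierstrassCurve.natCard_point_eq_one_add_card (ZMod 3) (@ZMod.instField 3 ⟨by norm_num⟩) _ _ _
    (by decide +kernel), @card_sol_eq_sum_euler (ZMod 3) (@ZMod.instField 3 ⟨by norm_num⟩) _ _
    (by rw [ZMod.ringChar_zmod_n]; decide), ZMod.card]
  decide +kernel
/-- `3025a1`'s Cremona model is an elliptic curve (`Δ ≠ 0`, kernel). [cite: Cremona2006, Table 1 (Cremona label 3025a1)] -/
theorem isElliptic_cm3025a1 : (⟨0, 1, 1, -183, 919⟩ : WeierstrassCurve ℚ).IsElliptic :=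
  isElliptic_of_discOf_ne_zero 0 1 1 (-183) 919 (by decide +kernel)

/-- `3025a1`'s Cremona model is globally minimal (Kraus' bounded criterion, kernel). [cite: SilvermanAEC2009, VII.1 Remark 1.1] -/
theorem isGloballyMinimal_cm3025a1 : (⟨0, 1, 1, -183, 919⟩ : WeierstrassCurve ℚ).IsGloballyMinimal :=
  isGloballyMinimal_of_krausCriterion_bounded₂ 0 1 1 (-183) 919 (by decide +kernel) (by decide +kernel)
    (by decide +kernel)

/-- `j(3025a1) = -32768 ∈ maximalCMJInvariants` (CM by the MAXIMAL order of `ℚ(√-11)`; kernel arithmetic on the literal model).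
[cite: SilvermanAEC2009, App. C §11.3.1] [cite: Cremona2006, Table 1 (Cremona label 3025a1)] -/
theorem j_mem_cm3025a1 :
    (haveI := isElliptic_cm3025a1; (⟨0, 1, 1, -183, 919⟩ : WeierstrassCurve ℚ).j) ∈ maximalCMJInvariants := by
  haveI := isElliptic_cm3025a1
  have hj : (⟨0, 1, 1, -183, 919⟩ : WeierstrassCurve ℚ).j = -32768 := by
    rw [j, Units.inv_mul_eq_iff_eq_mul, coe_Δ']
    norm_num [WeierstrassCurve.c₄, WeierstrassCurve.Δ, WeierstrassCurve.b₂, WeierstrassCurve.b₄,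
      WeierstrassCurve.b₆, WeierstrassCurve.b₈]
  rw [hj]
  simp [maximalCMJInvariants]

/-- `#Ã(𝔽₃) = 3` (`a₃ = 1`: GOOD ORDINARY at `3`) for the CM partner `3025a1` (kernel count). [folklore] -/
theorem card_cm3025a1_3 :
    Nat.card (((⟨0, 1, 1, -183, 919⟩ : WeierstrassCurve ℤ).map (Int.castRingHom (ZMod 3))).toAffine.Point) = 3 := by
  rw [@WeierstrassCurve.natCard_point_eq_one_add_card (ZMod 3) (@ZMod.instField 3 ⟨by norm_num⟩) _ _ _
    (by decide +kernel), @card_sol_eq_sum_euler (ZMod 3) (@ZMod.instField 3 ⟨by norm_num⟩) _ _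
    (by rw [ZMod.ringChar_zmod_n]; decide), ZMod.card]
  decide +kernel
/-- `5929a1`'s Cremona model is an elliptic curve (`Δ ≠ 0`, kernel). [cite: Cremona2006, Table 1 (Cremona label 5929a1)] -/
theorem isElliptic_cm5929a1 : (⟨0, 1, 1, -359, -2810⟩ : WeierstrassCurve ℚ).IsElliptic :=
  isElliptic_of_discOf_ne_zero 0 1 1 (-359) (-2810) (by decide +kernel)

/-- `5929a1`'s Cremona model is globally minimal (Kraus' bounded criterion, kernel). [cite: SilvermanAEC2009, VII.1 Remark 1.1] -/
theorem isGloballyMinimal_cm5929a1 : (⟨0, 1, 1, -359, -2810⟩ : WeierstrassCurve ℚ).IsGloballyMinimal :=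
  isGloballyMinimal_of_krausCriterion_bounded₂ 0 1 1 (-359) (-2810) (by decide +kernel) (by decide +kernel)
    (by decide +kernel)

/-- `j(5929a1) = -32768 ∈ maximalCMJInvariants` (CM by the MAXIMAL order of `ℚ(√-11)`; kernel arithmetic on the literal model).
[cite: SilvermanAEC2009, App. C §11.3.1] [cite: Cremona2006, Table 1 (Cremona label 5929a1)] -/
theorem j_mem_cm5929a1 :
    (haveI := isElliptic_cm5929a1; (⟨0, 1, 1, -359, -2810⟩ : WeierstrassCurve ℚ).j) ∈ maximalCMJInvariants := by
  haveI := isElliptic_cm5929a1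
  have hj : (⟨0, 1, 1, -359, -2810⟩ : WeierstrassCurve ℚ).j = -32768 := by
    rw [j, Units.inv_mul_eq_iff_eq_mul, coe_Δ']
    norm_num [WeierstrassCurve.c₄, WeierstrassCurve.Δ, WeierstrassCurve.b₂, WeierstrassCurve.b₄,
      WeierstrassCurve.b₆, WeierstrassCurve.b₈]
  rw [hj]
  simp [maximalCMJInvariants]

/-- `#Ã(𝔽₃) = 3` (`a₃ = 1`: GOOD ORDINARY at `3`) for the CM partner `5929a1` (kernel count). [folklore] -/
theorem card_cm5929a1_3 :
    Nat.card (((⟨0, 1, 1, -359, -2810⟩ : WeierstrassCurve ℤ).map (Int.castRingHom (ZMod 3))).toAffine.Point) = 3 := by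
  rw [@WeierstrassCurve.natCard_point_eq_one_add_card (ZMod 3) (@ZMod.instField 3 ⟨by norm_num⟩) _ _ _
    (by decide +kernel), @card_sol_eq_sum_euler (ZMod 3) (@ZMod.instField 3 ⟨by norm_num⟩) _ _
    (by rw [ZMod.ringChar_zmod_n]; decide), ZMod.card]
  decide +kernel
/-- `7744a1`'s Cremona model is an elliptic curve (`Δ ≠ 0`, kernel). [cite: Cremona2006, Table 1 (Cremona label 7744a1)] -/
theorem isElliptic_cm7744a1 : (⟨0, 1, 0, -29, 53⟩ : WeierstrassCurve ℚ).IsElliptic :=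
  isElliptic_of_discOf_ne_zero 0 1 0 (-29) 53 (by decide +kernel)

/-- `7744a1`'s Cremona model is globally minimal (Kraus' bounded criterion, kernel). [cite: SilvermanAEC2009, VII.1 Remark 1.1] -/
theorem isGloballyMinimal_cm7744a1 : (⟨0, 1, 0, -29, 53⟩ : WeierstrassCurve ℚ).IsGloballyMinimal :=
  isGloballyMinimal_of_krausCriterion_bounded₂ 0 1 0 (-29) 53 (by decide +kernel) (by decide +kernel)
    (by decide +kernel)

/-- `j(7744a1) = -32768 ∈ maximalCMJInvariants` (CM by the MAXIMAL order of `ℚ(√-11)`; kernel arithmetic on the literal model).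
[cite: SilvermanAEC2009, App. C §11.3.1] [cite: Cremona2006, Table 1 (Cremona label 7744a1)] -/
theorem j_mem_cm7744a1 :
    (haveI := isElliptic_cm7744a1; (⟨0, 1, 0, -29, 53⟩ : WeierstrassCurve ℚ).j) ∈ maximalCMJInvariants := by
  haveI := isElliptic_cm7744a1
  have hj : (⟨0, 1, 0, -29, 53⟩ : WeierstrassCurve ℚ).j = -32768 := by
    rw [j, Units.inv_mul_eq_iff_eq_mul, coe_Δ']
    norm_num [WeierstrassCurve.c₄, WeierstrassCurve.Δ, WeierstrassCurve.b₂, WeierstrassCurve.b₄,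
      WeierstrassCurve.b₆, WeierstrassCurve.b₈]
  rw [hj]
  simp [maximalCMJInvariants]

/-- `#Ã(𝔽₃) = 3` (`a₃ = 1`: GOOD ORDINARY at `3`) for the CM partner `7744a1` (kernel count). [folklore] -/
theorem card_cm7744a1_3 :
    Nat.card (((⟨0, 1, 0, -29, 53⟩ : WeierstrassCurve ℤ).map (Int.castRingHom (ZMod 3))).toAffine.Point) = 3 := by
  rw [@WeierstrassCurve.natCard_point_eq_one_add_card (ZMod 3) (@ZMod.instField 3 ⟨by norm_num⟩) _ _ _
    (by decide +kernel), @card_sol_eq_sum_euler (ZMod 3) (@ZMod.instField 3 ⟨by norm_num⟩) _ _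
    (by rw [ZMod.ringChar_zmod_n]; decide), ZMod.card]
  decide +kernel
/-- `7744s1`'s Cremona model is an elliptic curve (`Δ ≠ 0`, kernel). [cite: Cremona2006, Table 1 (Cremona label 7744s1)] -/
theorem isElliptic_cm7744s1 : (⟨0, -1, 0, -29, -53⟩ : WeierstrassCurve ℚ).IsElliptic :=
  isElliptic_of_discOf_ne_zero 0 (-1) 0 (-29) (-53) (by decide +kernel)

/-- `7744s1`'s Cremona model is globally minimal (Kraus' bounded criterion, kernel). [cite: SilvermanAEC2009, VII.1 Remark 1.1] -/
theorem isGloballyMinimal_cm7744s1 : (⟨0, -1, 0, -29, -53⟩ : WeierstrassCurve ℚ).IsGloballyMinimal :=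
  isGloballyMinimal_of_krausCriterion_bounded₂ 0 (-1) 0 (-29) (-53) (by decide +kernel) (by decide +kernel)
    (by decide +kernel)

/-- `j(7744s1) = -32768 ∈ maximalCMJInvariants` (CM by the MAXIMAL order of `ℚ(√-11)`; kernel arithmetic on the literal model).
[cite: SilvermanAEC2009, App. C §11.3.1] [cite: Cremona2006, Table 1 (Cremona label 7744s1)] -/
theorem j_mem_cm7744s1 :
    (haveI := isElliptic_cm7744s1; (⟨0, -1, 0, -29, -53⟩ : WeierstrassCurve ℚ).j) ∈ maximalCMJInvariants := by
  haveI := isElliptic_cm7744s1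
  have hj : (⟨0, -1, 0, -29, -53⟩ : WeierstrassCurve ℚ).j = -32768 := by
    rw [j, Units.inv_mul_eq_iff_eq_mul, coe_Δ']
    norm_num [WeierstrassCurve.c₄, WeierstrassCurve.Δ, WeierstrassCurve.b₂, WeierstrassCurve.b₄,
      WeierstrassCurve.b₆, WeierstrassCurve.b₈]
  rw [hj]
  simp [maximalCMJInvariants]

/-- `#Ã(𝔽₃) = 5` (`a₃ = -1`: GOOD ORDINARY at `3`) for the CM partner `7744s1` (kernel count). [folklore] -/
theorem card_cm7744s1_3 :
    Nat.card (((⟨0, -1, 0, -29, -53⟩ : WeierstrassCurve ℤ).map (Int.castRingHom (ZMod 3))).toAffine.Point) = 5 := by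
  rw [@WeierstrassCurve.natCard_point_eq_one_add_card (ZMod 3) (@ZMod.instField 3 ⟨by norm_num⟩) _ _ _
    (by decide +kernel), @card_sol_eq_sum_euler (ZMod 3) (@ZMod.instField 3 ⟨by norm_num⟩) _ _
    (by rw [ZMod.ringChar_zmod_n]; decide), ZMod.card]
  decide +kernel
/-- `20449a1`'s Cremona model is an elliptic curve (`Δ ≠ 0`, kernel). [cite: Cremona2006, Table 1 (Cremona label 20449a1)] -/
theorem isElliptic_cm20449a1 : (⟨0, -1, 1, -1239, 17643⟩ : WeierstrassCurve ℚ).IsElliptic :=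
  isElliptic_of_discOf_ne_zero 0 (-1) 1 (-1239) 17643 (by decide +kernel)

/-- `20449a1`'s Cremona model is globally minimal (Kraus' bounded criterion, kernel). [cite: SilvermanAEC2009, VII.1 Remark 1.1] -/
theorem isGloballyMinimal_cm20449a1 : (⟨0, -1, 1, -1239, 17643⟩ : WeierstrassCurve ℚ).IsGloballyMinimal :=
  isGloballyMinimal_of_krausCriterion_bounded₂ 0 (-1) 1 (-1239) 17643 (by decide +kernel) (by decide +kernel)
    (by decide +kernel)

/-- `j(20449a1) = -32768 ∈ maximalCMJInvariants` (CM by the MAXIMAL order of `ℚ(√-11)`; kernel arithmetic on the literal model).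
[cite: SilvermanAEC2009, App. C §11.3.1] [cite: Cremona2006, Table 1 (Cremona label 20449a1)] -/
theorem j_mem_cm20449a1 :
    (haveI := isElliptic_cm20449a1; (⟨0, -1, 1, -1239, 17643⟩ : WeierstrassCurve ℚ).j) ∈ maximalCMJInvariants := by
  haveI := isElliptic_cm20449a1
  have hj : (⟨0, -1, 1, -1239, 17643⟩ : WeierstrassCurve ℚ).j = -32768 := by
    rw [j, Units.inv_mul_eq_iff_eq_mul, coe_Δ']
    norm_num [WeierstrassCurve.c₄, WeierstrassCurve.Δ, WeierstrassCurve.b₂, WeierstrassCurve.b₄,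
      WeierstrassCurve.b₆, WeierstrassCurve.b₈]
  rw [hj]
  simp [maximalCMJInvariants]

/-- `#Ã(𝔽₃) = 5` (`a₃ = -1`: GOOD ORDINARY at `3`) for the CM partner `20449a1` (kernel count). [folklore] -/
theorem card_cm20449a1_3 :
    Nat.card (((⟨0, -1, 1, -1239, 17643⟩ : WeierstrassCurve ℤ).map (Int.castRingHom (ZMod 3))).toAffine.Point) = 5 := by
  rw [@WeierstrassCurve.natCard_point_eq_one_add_card (ZMod 3) (@ZMod.instField 3 ⟨by norm_num⟩) _ _ _
    (by decide +kernel), @card_sol_eq_sum_euler (ZMod 3) (@ZMod.instField 3 ⟨by norm_num⟩) _ _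
    (by rw [ZMod.ringChar_zmod_n]; decide), ZMod.card]
  decide +kernel
end Summit.BirchSwinnertonDyer.Rank1Residual.X10.CMPartnerCurves

end
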